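/-
Copyright (c) 2026 the pub-hodgecm-mathlib formalisation cell (harness21).  Prover seat hodgecm-mathlib-K2E1-p12 (g2), Track B ∕ K2-LIT, h413 =
`stmt-HodgeConjecture-24833`, line `K2_E1_TraceFormulaBeta`, (137)∕P4 «N = 2 RES-chain print», part 4 (capstone) — the `N = 2` twin (`U(1,1)_{L/L⁺}`, pole `ρ₀ = 1`, window `{½ < re}`)
of ★ p859768 `K2E1SphericalEisensteinResidueCuspidalCMThree` (K2E4-p10 (g6)): THE RESIDUE OF THE CONTINUED SPHERICAL EISENSTEIN SERIES OF `U(1,1)` AT `z = 1` IS THE CONSTANT `φ₀·r` —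
Langlands' lemma, `L²` proof (dealer K2E1-plan (g7) (137)∕(182), 2026-09-04).
-/
import Summits.HodgeConjecture.HodgeConjecture.Theorems.K2E1ContinuedEisensteinResidueConstantTermUTwo       -- THIS SEAT ★ p860015 (part 2): the residue function, its constant term (every Haar ∕ fundamental domain); brings ★ p859977 (part 1) the a.e. identification
import Summits.HodgeConjecture.HodgeConjecture.Theorems.K2E1SphericalEisensteinResidueOrthogonalCMTwo         -- THIS SEAT (part 3b): `horth_cm_two_of_letters` (the residue class is ⊥ cusp forms); brings ★ mean zero, the Siegel indicator
import Summits.HodgeConjecture.HodgeConjecture.Theorems.K2E1SphericalEisensteinResidueConstantCMThreeOfLetters -- ★ p859418 (rank-free §2): `exists_analyticAt_eventuallyEq_remainder_of_residue`; brings `inner_const_one_left`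
import Literature.NumberTheory.Automorphic.UnitaryGroupKernelDictionary                                     -- ★ `quotientSubgroup_quasiSplit`
import HarnessLib

/-!
# K2·E1 — `K2E1SphericalEisensteinResidueCuspidalCMTwo` ((137)∕P4 capstone, `U(1,1)_{L/L⁺}`): **`Res_{z=1} Ẽ(z)(g) = φ₀·r` FOR EVERY `g`** — the residue function minus `φ₀r` is a CONTINUOUS
# CUSP FORM whose `L²` class is the residue class minus `φ₀r·𝟙`, orthogonal to all cusp forms and to `𝟙`, hence zero

Track B ∕ K2-LIT, crux h413 = `stmt-HodgeConjecture-24833`, route of record `HCCMUnconditional`; cell `hodgecm-mathlib`, squad K2, ENGINE E1.  Prover seat `hodgecm-mathlib-K2E1-p12` (g2);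
deal (137)∕P4 of the dealer K2E1-plan (g7) (the 5-file letter-free `N = 2` RES-chain road: ★ p859977 part 1 → ★ p860033 part 1b → ★ p860015 part 2 → ★ p860044 part 3a → part 3b → this
capstone).  THEOREMS ONLY (no `def`, no `instance`, no notation, no named-fact hypothesis, no `sorry`); lane `--supports stmt-HodgeConjecture-24833 --as helper` (count-neutral).  Closes no
socket.  The byte-for-byte `N = 2` twin of ★ `K2E1SphericalEisensteinResidueCuspidalCMThree` with `3 ↦ 2`, pole `2 ↦ 1`, tube `2 < Re z ↦ 1 < Re z`, exponent `2 − z ↦ 1 − z`, window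
`{1 < re} ∖ {2} ↦ {½ < re} ∖ {1}` (the currency of ★ `K2E1SphericalEisensteinRegularRemainderCMTwoOfLetters.hres_cm_two_of_letters`).

THE MATHEMATICS ([MoeglinWaldspurger1995, IV.1.11]; [Langlands1976, §7, Lemma 7.5]; [BernsteinLapid2019, §4]).  `Ẽ(z)` = the meromorphically continued spherical Eisenstein series of
`U(1,1)_{L/L⁺}` (EXPORTS₂ letters (E1)(E2)(E2-bd)(E4), constant term (E3′)₂ `φ₀(H^z + c̃(z)H^{1−z})` with `(z−1)c̃(z) → r`, simple pole at `1` with pointwise residue `R(g) = F g 1`, letter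
(F)); `F_T(z) =ᵐ Λ^T Ẽ(z)` the operator road's holomorphic `L²`-valued family with `(z−1)F_T(z) → Res_T` in `L²` (MS bound).  THEN `ψ := R̃ − φ₀r` (`R̃[g] = R(g̃⁻¹)`) is continuous (★ part 1),
square-integrable (its class is `Res_T + φ₀r·[𝟙_{T<w₁}] − φ₀r·𝟙`, ★ part 1 a.e. identification), and all its constant terms along `N(𝔸)` vanish (★ part 2) — a CUSP FORM for the one-radical
datum `𝔓₀ = (N(𝔸))`; its class is orthogonal to every cusp form (★ (P-orth)₂ `horth_cm_two_of_letters` + ★ the Siegel indicator) and to `𝟙` (★ ROAD B «cusp forms have mean zero»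
`integral_eq_zero_of_mem_cuspForms_cm_two`), so `‖[ψ]‖² = ⟪Res_T + φ₀r[𝟙_{T<w₁}], [ψ]⟫ − φ₀r̄⟪𝟙,[ψ]⟫ = 0`: `ψ = 0` a.e., hence everywhere (continuity; automorphic measures charge open
sets), i.e. **`F g 1 = φ₀·r` for every `g ∈ G(𝔸)`** (`residueValue_eq_const_cm_two`), and the (RES)₂ conclusion follows (`exists_analyticAt_remainder_cm_two`: `Ẽ(z)(g) −
φ₀(H(g)^z + c̃(z)H(g)^{1−z})` extends analytically across `1`) — EXACTLY the conclusion shape of ★ `hres_cm_two_of_letters`, LETTER-FREE in its `horth`∕`hcusp`∕`hlink`.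
HONEST LABEL: HC_CM is proved only modulo the 7 printed citations (2 remaining named inputs: hLiu418 = `stmt-HodgeConjecture-24832`, h413 = `stmt-HodgeConjecture-24833`) until rung 0
closes; this file asserts no named fact and closes no socket; both heads are CONDITIONAL on the EXPORTS₂ letters (E1)(E2)(E2-bd)(E4)(E3′)₂, the pole letters (F) and `(z−1)c̃(z) → r`, and
the operator road's `(F_T, hFd, hFam, Res_T, hRes)` at `N = 2`.
References: [MoeglinWaldspurger1995] IV.1.11, I.2.18 · [Langlands1976] §7 · [BernsteinLapid2019] §4 p. 10 · [BorelJacquet1979] §4.4–§4.6.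
-/

set_option autoImplicit false
-- the mandated namespace repeats the single-problem summit's segment (`HodgeConjecture.HodgeConjecture`)
set_option linter.dupNamespace false

noncomputable section

open MeasureTheory Measure NumberField IsDedekindDomain Set Filter Topology Metric
open scoped ENNReal NNReal InnerProductSpace ComplexConjugate
open Literature.NumberTheory.Automorphic Literature.NumberTheory.Automorphic.UnitaryGroup AdelicGroupData
open Summit.HodgeConjecture.HodgeConjecture.Cruxes.H413.K2E1BorelEisensteinU
open Summit.HodgeConjecture.HodgeConjecture.Cruxes.H413.K2E1BLBorelSpacesU2Defs
open Summit.HodgeConjecture.HodgeConjecture.Cruxes.H413.K2E1ContinuedEisensteinResidueFunctionUTwo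
open Summit.HodgeConjecture.HodgeConjecture.Cruxes.H413.K2E1ContinuedEisensteinResidueConstantTermUTwo
open Summit.HodgeConjecture.HodgeConjecture.Cruxes.H413.K2E1SphericalEisensteinResidueOrthogonalU (memLp_quotFun_siegelIndicator)
open Summit.HodgeConjecture.HodgeConjecture.Cruxes.H413.K2E1SphericalEisensteinResidueOrthogonalCMTwo (horth_cm_two_of_letters)
open Summit.HodgeConjecture.HodgeConjecture.Cruxes.H413.K2E1CuspFormsMeanZeroSoftUCM (integral_eq_zero_of_mem_cuspForms_cm_two)
open Summit.HodgeConjecture.HodgeConjecture.Cruxes.H413.K2E1ConstantLineResidualU2 (inner_const_one_left)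
open Summit.HodgeConjecture.HodgeConjecture.Cruxes.H413.K2E1SphericalEisensteinResidueConstantCMThreeOfLetters (exists_analyticAt_eventuallyEq_remainder_of_residue)

namespace Summit.HodgeConjecture.HodgeConjecture.Cruxes.H413.K2E1SphericalEisensteinResidueCuspidalCMTwo

variable (L : Type) [Field L] [NumberField L] [IsCMField L]
variable [MeasurableSpace (quasiSplit (↥(maximalRealSubfield L)) L (IsCMField.complexConj L) 2).Adelic] [BorelSpace (quasiSplit (↥(maximalRealSubfield L)) L (IsCMField.complexConj L) 2).Adelic]

/-- **THE RESIDUE OF THE CONTINUED SPHERICAL EISENSTEIN SERIES OF `U(1,1)` AT `z = 1` IS THE CONSTANT `φ₀·r`: `F g 1 = φ₀·r` FOR EVERY `g`.**  DATA (all hypothesis-first): `μ` automorphic; `ν`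
Haar on `N(𝔸)` with a fundamental domain `𝓕` of compact closure; `φ₀`; `T ≥ 1`; the continued values `Ec` on an open preconnected `D ⊇ B(1,ρ)∖{1}` containing a neighbourhood of a real tube
point `σ₀ > 1`, with (E1) `hEd`, (E4) `hE4`, (E2-bd) `hEbd`, left-`G(L⁺)`-invariance `hEcinv`, the tube agreement (E2) `hE2`; the continued constant term (E3′) `hE3` with coefficient
`c̃`, `(z−1)c̃(z) → r`; the pole letter (F) `hF`, `hFE`; the operator road's family `Fam` (holomorphic on `D`, `Fam z =ᵐ Λ^T(Ec z)`) and its residue class `Res` (`(z−1)•Fam z → Res`).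
[cite: MoeglinWaldspurger1995, IV.1.11] [cite: Langlands1976, §7] [cite: BernsteinLapid2019, §4 p. 10] -/
theorem residueValue_eq_const_cm_two
    (μ : Measure (quasiSplit (↥(maximalRealSubfield L)) L (IsCMField.complexConj L) 2).automorphicQuotient) [(quasiSplit (↥(maximalRealSubfield L)) L (IsCMField.complexConj L) 2).IsAutomorphicMeasure μ]
    (ν : Measure ↥(adelicUnipotent (↥(maximalRealSubfield L)) L (IsCMField.complexConj L) 2)) [ν.IsHaarMeasure]
    {𝓕 : Set ↥(adelicUnipotent (↥(maximalRealSubfield L)) L (IsCMField.complexConj L) 2)}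
    (h𝓕N : IsFundamentalDomain ↥(rationalUnipotent (↥(maximalRealSubfield L)) L (IsCMField.complexConj L) 2) 𝓕 ν) (h𝓕c : IsCompact (closure 𝓕))
    (φ₀ : ℂ) {T : ℝ≥0} (hT : 1 ≤ T)
    (Ec : ℂ → (quasiSplit (↥(maximalRealSubfield L)) L (IsCMField.complexConj L) 2).Adelic → ℂ) {D : Set ℂ} (hDo : IsOpen D) (hDc : IsPreconnected D)
    {σ₀ : ℝ} (hσ₀ : 1 < σ₀) (hσD : ∀ᶠ z in 𝓝 ((σ₀ : ℝ) : ℂ), z ∈ D) {ρ : ℝ} (hρ : 0 < ρ) (hρD : ∀ z : ℂ, z ≠ 1 → dist z 1 < ρ → z ∈ D)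
    (hEd : ∀ g, DifferentiableOn ℂ (fun z => Ec z g) D) (hE4 : ∀ z ∈ D, Continuous (Ec z))
    (hEbd : ∀ z₀ ∈ D, ∀ K : Set (quasiSplit (↥(maximalRealSubfield L)) L (IsCMField.complexConj L) 2).Adelic, IsCompact K → ∃ V ∈ 𝓝 z₀, ∃ M : ℝ, ∀ z ∈ V, ∀ g ∈ K, ‖Ec z g‖ ≤ M)
    (hEcinv : ∀ z ∈ D, ∀ (γ : (quasiSplit (↥(maximalRealSubfield L)) L (IsCMField.complexConj L) 2).arithmeticSubgroup) (x : (quasiSplit (↥(maximalRealSubfield L)) L (IsCMField.complexConj L) 2).Adelic),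
      Ec z ((γ : (quasiSplit (↥(maximalRealSubfield L)) L (IsCMField.complexConj L) 2).Adelic) * x) = Ec z x)
    (hE2 : ∀ z ∈ D, 1 < z.re → Ec z = eisensteinSeriesU (flatSectionU (fun _ : (quasiSplit (↥(maximalRealSubfield L)) L (IsCMField.complexConj L) 2).Adelic => φ₀) z))
    {cc : ℂ → ℂ} {r : ℂ} (hcres : Tendsto (fun z : ℂ => (z - 1) * cc z) (𝓝[≠] 1) (𝓝 r))
    (hE3 : ∀ z ∈ D, ∀ g : (quasiSplit (↥(maximalRealSubfield L)) L (IsCMField.complexConj L) 2).Adelic,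
      borelConstantTerm ν 𝓕 (Ec z) g = φ₀ * ((((borelHeight g : ℝ≥0) : ℝ) : ℂ) ^ z + cc z * (((borelHeight g : ℝ≥0) : ℝ) : ℂ) ^ (1 - z)))
    (Fp : (quasiSplit (↥(maximalRealSubfield L)) L (IsCMField.complexConj L) 2).Adelic → ℂ → ℂ) (hF : ∀ g, AnalyticAt ℂ (Fp g) 1) (hFE : ∀ g, Fp g =ᶠ[𝓝[≠] 1] fun z => (z - 1) * Ec z g)
    (Fam : ℂ → (quasiSplit (↥(maximalRealSubfield L)) L (IsCMField.complexConj L) 2).L2 μ) (hFd : DifferentiableOn ℂ Fam D)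
    (hFam : ∀ z ∈ D, ((Fam z : (quasiSplit (↥(maximalRealSubfield L)) L (IsCMField.complexConj L) 2).L2 μ) : (quasiSplit (↥(maximalRealSubfield L)) L (IsCMField.complexConj L) 2).automorphicQuotient → ℂ) =ᵐ[μ]
      (quasiSplit (↥(maximalRealSubfield L)) L (IsCMField.complexConj L) 2).quotFun (truncation ν 𝓕 T (Ec z)))
    (Res : (quasiSplit (↥(maximalRealSubfield L)) L (IsCMField.complexConj L) 2).L2 μ) (hRes : Tendsto (fun z : ℂ => (z - 1) • Fam z) (𝓝[≠] 1) (𝓝 Res)) :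
    ∀ g : (quasiSplit (↥(maximalRealSubfield L)) L (IsCMField.complexConj L) 2).Adelic, Fp g 1 = φ₀ * r := by
  haveI := t2Space_adeleRing_of_numberField L
  haveI : T2Space (quasiSplit (↥(maximalRealSubfield L)) L (IsCMField.complexConj L) 2).Adelic :=
    inferInstanceAs (T2Space (adelic (↥(maximalRealSubfield L)) L (IsCMField.complexConj L) 2 ((StdForm.antidiagonal 2).over L)))
  have hc : (IsCMField.complexConj L) * (IsCMField.complexConj L) = 1 := AlgEquiv.ext fun x => IsCMField.complexConj_apply_apply L x
  have hD1 : ∀ᶠ z in 𝓝[≠] (1 : ℂ), z ∈ D := by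
    filter_upwards [inter_mem_nhdsWithin _ (ball_mem_nhds (1 : ℂ) hρ)] with z hz
    exact hρD z hz.1 (mem_ball.1 hz.2)
  set κ : ℂ := φ₀ * r with hκ
  -- the residue function `R = F · 1`: continuous and left-`G(L⁺)`-invariant
  have hRc : Continuous fun g : (quasiSplit (↥(maximalRealSubfield L)) L (IsCMField.complexConj L) 2).Adelic => Fp g 1 :=
    continuous_residueValue Ec hDo hρ hρD hEd hE4 hEbd Fp hF hFE
  have hRinv : ∀ γ ∈ (quasiSplit (↥(maximalRealSubfield L)) L (IsCMField.complexConj L) 2).quotientSubgroup, ∀ g : (quasiSplit (↥(maximalRealSubfield L)) L (IsCMField.complexConj L) 2).Adelic,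
      (fun t : (quasiSplit (↥(maximalRealSubfield L)) L (IsCMField.complexConj L) 2).Adelic => Fp t 1) (γ * g) = (fun t => Fp t 1) g := fun γ hγ g => by
    rw [quotientSubgroup_quasiSplit] at hγ
    exact residueValue_rational_mul Ec hD1 hEcinv Fp hF hFE ⟨γ, hγ⟩ g
  -- the function `ψ = R̃ − κ` on `𝔛`
  set ψ : (quasiSplit (↥(maximalRealSubfield L)) L (IsCMField.complexConj L) 2).automorphicQuotient → ℂ :=
    fun x => (quasiSplit (↥(maximalRealSubfield L)) L (IsCMField.complexConj L) 2).quotFun (fun t => Fp t 1) x - κ with hψ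
  have hψc : Continuous ψ := (AdelicGroupData.continuous_quotFun hRinv hRc).sub continuous_const
  -- the Siegel indicator class and the residue class `Fres = Res + κ • ind`
  have hm := memLp_quotFun_siegelIndicator (F := (↥(maximalRealSubfield L))) (E := L) (c := (IsCMField.complexConj L)) (N := 2) μ 2 T
  set ind : (quasiSplit (↥(maximalRealSubfield L)) L (IsCMField.complexConj L) 2).L2 μ := hm.toLp _ with hind_def
  have hind_ae : ((ind : (quasiSplit (↥(maximalRealSubfield L)) L (IsCMField.complexConj L) 2).L2 μ) : (quasiSplit (↥(maximalRealSubfield L)) L (IsCMField.complexConj L) 2).automorphicQuotient → ℂ) =ᵐ[μ]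
      fun x => if T < supHeight (↥(maximalRealSubfield L)) L (IsCMField.complexConj L) 2 x then (1 : ℂ) else 0 := by
    filter_upwards [hm.coeFn_toLp] with x hx
    rw [hind_def, hx]
    change (if T < supHeight (↥(maximalRealSubfield L)) L (IsCMField.complexConj L) 2 ((quasiSplit (↥(maximalRealSubfield L)) L (IsCMField.complexConj L) 2).toAutomorphicQuotient
      (Quotient.out (x : (quasiSplit (↥(maximalRealSubfield L)) L (IsCMField.complexConj L) 2).Adelic ⧸ (quasiSplit (↥(maximalRealSubfield L)) L (IsCMField.complexConj L) 2).quotientSubgroup))⁻¹⁻¹) then (1 : ℂ) else 0) = _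
    rw [inv_inv, show (quasiSplit (↥(maximalRealSubfield L)) L (IsCMField.complexConj L) 2).toAutomorphicQuotient
      (Quotient.out (x : (quasiSplit (↥(maximalRealSubfield L)) L (IsCMField.complexConj L) 2).Adelic ⧸ (quasiSplit (↥(maximalRealSubfield L)) L (IsCMField.complexConj L) 2).quotientSubgroup)) = x from Quotient.out_eq _]
  -- `ψ` is a.e. the representative of `Res + κ • ind − κ • 𝟙`
  have hRes_ae := ae_eq_residueValue_sub_indicator μ ν h𝓕N hT φ₀ Ec hD1 hEcinv hcres hE3 Fp hF hFE Fam hFam Res hRes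
  set V : (quasiSplit (↥(maximalRealSubfield L)) L (IsCMField.complexConj L) 2).L2 μ :=
    Res + κ • ind - κ • (Lp.const 2 μ (1 : ℂ) : (quasiSplit (↥(maximalRealSubfield L)) L (IsCMField.complexConj L) 2).L2 μ) with hVdef
  have hψae : ψ =ᵐ[μ] ((V : (quasiSplit (↥(maximalRealSubfield L)) L (IsCMField.complexConj L) 2).L2 μ) : (quasiSplit (↥(maximalRealSubfield L)) L (IsCMField.complexConj L) 2).automorphicQuotient → ℂ) := by
    filter_upwards [hRes_ae, hind_ae, Lp.coeFn_sub (Res + κ • ind) (κ • (Lp.const 2 μ (1 : ℂ) : (quasiSplit (↥(maximalRealSubfield L)) L (IsCMField.complexConj L) 2).L2 μ)),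
      Lp.coeFn_add Res (κ • ind), Lp.coeFn_smul κ ind, Lp.coeFn_smul κ (Lp.const 2 μ (1 : ℂ) : (quasiSplit (↥(maximalRealSubfield L)) L (IsCMField.complexConj L) 2).L2 μ),
      Lp.coeFn_const 2 μ (1 : ℂ)] with x hR hI hsub hadd hsm1 hsm2 h1
    rw [hVdef, hsub, Pi.sub_apply, hadd, Pi.add_apply, hsm1, Pi.smul_apply, hsm2, Pi.smul_apply, hR, hI, h1, hψ]
    simp only [Function.const_apply, smul_eq_mul, mul_one]
    change Fp (Quotient.out (x : (quasiSplit (↥(maximalRealSubfield L)) L (IsCMField.complexConj L) 2).Adelic ⧸ (quasiSplit (↥(maximalRealSubfield L)) L (IsCMField.complexConj L) 2).quotientSubgroup))⁻¹ 1 - κ = _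
    split_ifs <;> ring
  have hψ2 : MemLp ψ 2 μ := (Lp.memLp V).ae_eq hψae.symm
  have hVψ : hψ2.toLp ψ = V := by
    refine Lp.ext ?_
    filter_upwards [hψ2.coeFn_toLp, hψae] with x hx hx'
    rw [hx, hx']
  -- the one-radical parabolic datum `𝔓₀ = (N(𝔸))` and the cusp condition of `ψ`
  have hB0 : @BorelSpace ↥(adelicUnipotent (↥(maximalRealSubfield L)) L (IsCMField.complexConj L) 2) _ Subtype.instMeasurableSpace := inferInstance
  have hCT : ConstantTermVanishes (⟨PUnit, fun _ => adelicUnipotent (↥(maximalRealSubfield L)) L (IsCMField.complexConj L) 2⟩ :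
      (quasiSplit (↥(maximalRealSubfield L)) L (IsCMField.complexConj L) 2).ParabolicUnipotentData) ψ PUnit.unit := by
    intro m hB ν' hν' 𝓕' h𝓕' x
    have hmeq : m = Subtype.instMeasurableSpace :=
      (@BorelSpace.measurable_eq _ _ m hB).trans (@BorelSpace.measurable_eq _ _ _ hB0).symm
    subst hmeq
    have hx : ∀ u : ↥(adelicUnipotent (↥(maximalRealSubfield L)) L (IsCMField.complexConj L) 2),
        ψ ((quasiSplit (↥(maximalRealSubfield L)) L (IsCMField.complexConj L) 2).toAutomorphicQuotient (x * (u : (quasiSplit (↥(maximalRealSubfield L)) L (IsCMField.complexConj L) 2).Adelic)⁻¹)) =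
          Fp ((u : (quasiSplit (↥(maximalRealSubfield L)) L (IsCMField.complexConj L) 2).Adelic) * x⁻¹) 1 - κ := fun u => by
      rw [hψ]
      change (quasiSplit (↥(maximalRealSubfield L)) L (IsCMField.complexConj L) 2).quotFun (fun t => Fp t 1) _ - κ = _
      rw [AdelicGroupData.quotFun_toAutomorphicQuotient hRinv, mul_inv_rev, inv_inv]
    simp_rw [hx]
    exact integrableOn_and_setIntegral_residueValue_sub_eq_zero hc ν' h𝓕' ν h𝓕N φ₀ Ec hDo hρ hρD hEd hE4 hEbd hEcinv hcres hE3 Fp hF hFE x⁻¹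
  have hψmem : ψ ∈ (quasiSplit (↥(maximalRealSubfield L)) L (IsCMField.complexConj L) 2).cuspForms μ
      (⟨PUnit, fun _ => adelicUnipotent (↥(maximalRealSubfield L)) L (IsCMField.complexConj L) 2⟩ : (quasiSplit (↥(maximalRealSubfield L)) L (IsCMField.complexConj L) 2).ParabolicUnipotentData) :=
    ⟨hψc, hψ2, fun _ => hCT⟩
  -- `[ψ] ⊥` every cusp form (★ (P-orth)) and `⊥ 𝟙` (★ ROAD B mean zero): `‖[ψ]‖² = 0`
  have horth := horth_cm_two_of_letters L μ ν h𝓕N h𝓕c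
    (⟨PUnit, fun _ => adelicUnipotent (↥(maximalRealSubfield L)) L (IsCMField.complexConj L) 2⟩ : (quasiSplit (↥(maximalRealSubfield L)) L (IsCMField.complexConj L) 2).ParabolicUnipotentData)
    PUnit.unit rfl φ₀ hT Ec hDo hDc hσ₀ hσD hD1 hE2 Fam hFd hFam Res hRes ind (fun _ => rfl) κ ⟨ψ, hψmem⟩
  have hmean := integral_eq_zero_of_mem_cuspForms_cm_two L μ
    (⟨PUnit, fun _ => adelicUnipotent (↥(maximalRealSubfield L)) L (IsCMField.complexConj L) 2⟩ : (quasiSplit (↥(maximalRealSubfield L)) L (IsCMField.complexConj L) 2).ParabolicUnipotentData)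
    PUnit.unit rfl ψ hψmem
  have hΨ : (quasiSplit (↥(maximalRealSubfield L)) L (IsCMField.complexConj L) 2).cuspFormsToLp μ _ ⟨ψ, hψmem⟩ = V := by
    rw [AdelicGroupData.cuspFormsToLp_apply, ← hVψ]
  rw [hΨ] at horth
  have h1 : ⟪(Lp.const 2 μ (1 : ℂ) : (quasiSplit (↥(maximalRealSubfield L)) L (IsCMField.complexConj L) 2).L2 μ), V⟫_ℂ = 0 := by
    rw [inner_const_one_left, ← hVψ, integral_congr_ae hψ2.coeFn_toLp, hmean]
  have hV0 : V = 0 := by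
    rw [← inner_self_eq_zero (𝕜 := ℂ)]
    have h : ⟪V, V⟫_ℂ = ⟪Res + κ • ind, V⟫_ℂ - conj κ * ⟪(Lp.const 2 μ (1 : ℂ) : (quasiSplit (↥(maximalRealSubfield L)) L (IsCMField.complexConj L) 2).L2 μ), V⟫_ℂ := by
      rw [hVdef, inner_sub_left, inner_smul_left]
    rw [h, horth, h1, mul_zero, sub_zero]
  -- `ψ = 0` a.e., hence everywhere (continuity; automorphic measures charge open sets)
  have hψ0 : ψ = 0 := by
    have hae : ψ =ᵐ[μ] (0 : (quasiSplit (↥(maximalRealSubfield L)) L (IsCMField.complexConj L) 2).automorphicQuotient → ℂ) := by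
      have h := hψae
      rw [hV0] at h
      exact h.trans (Lp.coeFn_zero ℂ 2 μ)
    exact (Continuous.ae_eq_iff_eq μ hψc continuous_const).1 hae
  intro g
  have h := congrFun hψ0 ((quasiSplit (↥(maximalRealSubfield L)) L (IsCMField.complexConj L) 2).toAutomorphicQuotient g⁻¹)
  rw [hψ, Pi.zero_apply] at h
  change (quasiSplit (↥(maximalRealSubfield L)) L (IsCMField.complexConj L) 2).quotFun (fun t => Fp t 1) _ - κ = 0 at h
  rwa [AdelicGroupData.quotFun_toAutomorphicQuotient hRinv, inv_inv, sub_eq_zero] at h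

/-- **THE (L4b)∕(RES) CONCLUSION OF ★ p859395∕p859418, LETTER-FREE IN `hlink`∕`hcusp`∕`horth`**: under the data of `residueValue_eq_const_cm_two` and with `c̃` holomorphic on a punctured
neighbourhood of `1` inside `{½ < re}`, for every `g` the function `z ↦ Ẽ(z)(g) − φ₀·(H(g)^z + c̃(z)·H(g)^{1−z})` extends analytically across `z = 1` — EXACTLY the conclusion shape of ★
`hres_cm_two_of_letters` (★ §2 `exists_analyticAt_eventuallyEq_remainder_of_residue` at the residue value `φ₀r`). [cite: MoeglinWaldspurger1995, IV.1.11] [cite: Langlands1976, §7] -/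
theorem exists_analyticAt_remainder_cm_two
    (μ : Measure (quasiSplit (↥(maximalRealSubfield L)) L (IsCMField.complexConj L) 2).automorphicQuotient) [(quasiSplit (↥(maximalRealSubfield L)) L (IsCMField.complexConj L) 2).IsAutomorphicMeasure μ]
    (ν : Measure ↥(adelicUnipotent (↥(maximalRealSubfield L)) L (IsCMField.complexConj L) 2)) [ν.IsHaarMeasure]
    {𝓕 : Set ↥(adelicUnipotent (↥(maximalRealSubfield L)) L (IsCMField.complexConj L) 2)}
    (h𝓕N : IsFundamentalDomain ↥(rationalUnipotent (↥(maximalRealSubfield L)) L (IsCMField.complexConj L) 2) 𝓕 ν) (h𝓕c : IsCompact (closure 𝓕))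
    (φ₀ : ℂ) {T : ℝ≥0} (hT : 1 ≤ T)
    (Ec : ℂ → (quasiSplit (↥(maximalRealSubfield L)) L (IsCMField.complexConj L) 2).Adelic → ℂ) {D : Set ℂ} (hDo : IsOpen D) (hDc : IsPreconnected D)
    {σ₀ : ℝ} (hσ₀ : 1 < σ₀) (hσD : ∀ᶠ z in 𝓝 ((σ₀ : ℝ) : ℂ), z ∈ D) {ρ : ℝ} (hρ : 0 < ρ) (hρD : ∀ z : ℂ, z ≠ 1 → dist z 1 < ρ → z ∈ D)
    (hEd : ∀ g, DifferentiableOn ℂ (fun z => Ec z g) D) (hE4 : ∀ z ∈ D, Continuous (Ec z))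
    (hEbd : ∀ z₀ ∈ D, ∀ K : Set (quasiSplit (↥(maximalRealSubfield L)) L (IsCMField.complexConj L) 2).Adelic, IsCompact K → ∃ V ∈ 𝓝 z₀, ∃ M : ℝ, ∀ z ∈ V, ∀ g ∈ K, ‖Ec z g‖ ≤ M)
    (hEcinv : ∀ z ∈ D, ∀ (γ : (quasiSplit (↥(maximalRealSubfield L)) L (IsCMField.complexConj L) 2).arithmeticSubgroup) (x : (quasiSplit (↥(maximalRealSubfield L)) L (IsCMField.complexConj L) 2).Adelic),
      Ec z ((γ : (quasiSplit (↥(maximalRealSubfield L)) L (IsCMField.complexConj L) 2).Adelic) * x) = Ec z x)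
    (hE2 : ∀ z ∈ D, 1 < z.re → Ec z = eisensteinSeriesU (flatSectionU (fun _ : (quasiSplit (↥(maximalRealSubfield L)) L (IsCMField.complexConj L) 2).Adelic => φ₀) z))
    {cc : ℂ → ℂ} {r : ℂ} (hchol : DifferentiableOn ℂ cc ({z : ℂ | 1 / 2 < z.re} \ {1})) (hcres : Tendsto (fun z : ℂ => (z - 1) * cc z) (𝓝[≠] 1) (𝓝 r))
    (hE3 : ∀ z ∈ D, ∀ g : (quasiSplit (↥(maximalRealSubfield L)) L (IsCMField.complexConj L) 2).Adelic,
      borelConstantTerm ν 𝓕 (Ec z) g = φ₀ * ((((borelHeight g : ℝ≥0) : ℝ) : ℂ) ^ z + cc z * (((borelHeight g : ℝ≥0) : ℝ) : ℂ) ^ (1 - z)))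
    (Fp : (quasiSplit (↥(maximalRealSubfield L)) L (IsCMField.complexConj L) 2).Adelic → ℂ → ℂ) (hF : ∀ g, AnalyticAt ℂ (Fp g) 1) (hFE : ∀ g, Fp g =ᶠ[𝓝[≠] 1] fun z => (z - 1) * Ec z g)
    (Fam : ℂ → (quasiSplit (↥(maximalRealSubfield L)) L (IsCMField.complexConj L) 2).L2 μ) (hFd : DifferentiableOn ℂ Fam D)
    (hFam : ∀ z ∈ D, ((Fam z : (quasiSplit (↥(maximalRealSubfield L)) L (IsCMField.complexConj L) 2).L2 μ) : (quasiSplit (↥(maximalRealSubfield L)) L (IsCMField.complexConj L) 2).automorphicQuotient → ℂ) =ᵐ[μ]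
      (quasiSplit (↥(maximalRealSubfield L)) L (IsCMField.complexConj L) 2).quotFun (truncation ν 𝓕 T (Ec z)))
    (Res : (quasiSplit (↥(maximalRealSubfield L)) L (IsCMField.complexConj L) 2).L2 μ) (hRes : Tendsto (fun z : ℂ => (z - 1) • Fam z) (𝓝[≠] 1) (𝓝 Res)) :
    ∀ g : (quasiSplit (↥(maximalRealSubfield L)) L (IsCMField.complexConj L) 2).Adelic, ∃ G : ℂ → ℂ, AnalyticAt ℂ G 1 ∧ G =ᶠ[𝓝[≠] 1] (fun z => Ec z g -
      φ₀ * ((((borelHeight g : ℝ≥0) : ℝ) : ℂ) ^ z + cc z * (((borelHeight g : ℝ≥0) : ℝ) : ℂ) ^ ((1 : ℂ) - z))) := by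
  have hval := residueValue_eq_const_cm_two L μ ν h𝓕N h𝓕c φ₀ hT Ec hDo hDc hσ₀ hσD hρ hρD hEd hE4 hEbd hEcinv hE2 hcres hE3 Fp hF hFE Fam hFd hFam Res hRes
  have hU : {z : ℂ | 1 / 2 < z.re} ∈ 𝓝 (1 : ℂ) := (isOpen_lt continuous_const Complex.continuous_re).mem_nhds (by show (1 : ℝ) / 2 < (1 : ℂ).re; norm_num)
  intro g
  exact exists_analyticAt_eventuallyEq_remainder_of_residue φ₀ (NNReal.coe_pos.2 (borelHeight_pos g)) (hF g) (hFE g) (hval g) hU hchol hcres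

end Summit.HodgeConjecture.HodgeConjecture.Cruxes.H413.K2E1SphericalEisensteinResidueCuspidalCMTwo

end
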